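import Summits.ResolutionOfSingularities.ResolutionOfSingularities.Theorems.EquisingularLiftEquisingularLiftNatDeltaConeLiftCentred
import Mathlib
import HarnessLib

/-!
# [OURS · L1 W4.5(b) · EL♮] T-ΔLIFT-CENTRED in ANY relative dimension — a Δ-regular CENTRED cone lift `Φ = G₀ + c·ϖ·M`
# of a form `g ∈ k[T_σ]_d` of multiplicity `≥ m` at the coordinate point `q = e_{i₀}`: regular along `ϖ` on every chart
# `T_i = 1` (`i ≠ i₀`) AND on every chart of the blow-up of the section over `q` (crux `EquisingularLiftNat`
# stmt-ResolutionOfSingularities-20038 (∀ n), line `sections`, rung v7 (TC⁺), any-`n` stub `stub_elnat_tcPlusPointResolution`)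

NOT a statement of any manuscript. Helper file of the chain res-L1-w45b (cell `res-hironaka`, LADDER-RESOLUTION rung L,
slot W4.5(b)); OURS; AI-written, weaker than expert review; `--supports stmt-ResolutionOfSingularities-20038 --as helper` by
res-L1-w45b-stub-2 (object T-ΔLIFT-CENTRED-r). No `sorry`; standard axioms. It closes nothing by itself.

WHERE IT SITS. res-L1-w45b-stub-1's T-ΔLIFT-CENTRED `exists_isHomogeneous_centred_lift_deltaRegular` (…NatDeltaConeLiftCentred,
p523916) is the PLANE case `σ = Fin 3`, `q = [1:0:0]` of the member package of the sub-chain supplier HSUB′(ReachTC⁺) at relative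
dimension `3`. The registered PARENT stub and the frozen supplier text are stated for EVERY relative dimension `n`; the any-`n`
supplier needs the same package on the exceptional carrier `e ≅ ℙ^{n-1}` (res-L1-w45b-stub-1, Q3 of 2026-08-27T10:44:46Z: «general
`r` needs its `Fin r` version + T-PTPRIME-DICT»; the finiteness inputs below are what T-PTPRIME-DICT
`finite_badPrimes_of_finite_nonregular_carrierTrace` (p526020) produces from «finitely many non-regular points of the trace»).
This file is that version, over an ARBITRARY finite index set `σ` with a distinguished index `i₀` (the centre `q = e_{i₀}`):

* `aeval_mem_span_pow_of_forall_dvd` / `aeval_mem_pow_of_forall_mem` — a polynomial all of whose monomials have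
  `Σ_{j ≠ i₀} α_j ≥ m` (spelled `m + α_{i₀} ≤ |α|`) goes to `(wᵐ)` (resp. `J^m`) under any substitution `v` with `w ∣ v j`
  (resp. `v j ∈ J`) for `j ≠ i₀` — the second is «order `≥ m` along the section ideal»;
* `aeval_dehomogenize_eq_aeval`, `map_blowupSubst`, `map_aeval_blowupSubst_dehomogenize`, `aeval_blowupSubst_dehomogenize_mem_span_pow`
  — the strict-transform substitution of the chart with pivot `l ≠ i₀` of the blow-up of `q` = the dehomogenisation `T_{i₀} ↦ 1`
  (Literature `dehomogenize i₀`) followed by the affine blow-up substitution `X_l ↦ X_l`, `X_j ↦ X_l·X_j` of res-L1-w45b-stub-4's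
  …NatBlowupSubstSquarefree (inline, as there: `aeval (fun j => if j = l then X l else X l * X j)`), and reduction of coefficients;
* **`exists_isHomogeneous_centred_lift_deltaRegular_of_ne`** (+ `…_of_ne'` with `ker π = 𝔪_O`): `O` a DVR, `ϖ` irreducible,
  `π : O ↠ k` onto an INFINITE field, `ker π = (ϖ)`; `m ≤ d`; `g ∈ k[T_σ]` a form of degree `d` with `supp g ⊆ {m + α_{i₀} ≤ |α|}`;
  on every chart `T_i = 1`, `i ≠ i₀`, the bad primes of `g(T_i := 1)` (`∈ 𝔮 ∩ 𝔪_𝔮²`) are finitely many; for every pivot `l ≠ i₀`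
  the downstairs strict transform `g_l` (`β_l (g(T_{i₀} := 1)) = X_l^m · g_l`) has finitely many bad primes ⟹ THERE IS a form
  `Φ ∈ O[T_σ]_d` with `π Φ = g`, `supp Φ ⊆ {m + α_{i₀} ≤ |α|}`, and strict transforms `Φ_l` with `β_l (Φ(T_{i₀} := 1)) = X_l^m · Φ_l`,
  `π Φ_l = g_l`, such that every `O[T_j : j ≠ i]/(Φ(T_i := 1))` (`i ≠ i₀`) and every `O[X_j : j ≠ i₀]/(Φ_l)` is a regular local ring
  at every prime containing `ϖ` (res-type-100's F3b `hreg` binder shape, `2(|σ| - 1)` charts). The chart `T_{i₀} = 1` itself is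
  omitted on purpose: its only point not on another chart is `q`, which is blown up.

Construction (as in p523916): `Φ = G₀ + c·ϖ·M`, `G₀` the support-wise lift of `g`, `M` a lift of a centred degree-`d` form `M̄`
avoiding every bad prime on every chart (witnesses `T_i^d`, `T_{i₀}^{d-m} T_l^m`; `Submodule.exists_forall_notMem_of_forall_ne_top`),
`π c` off the exclusion sets of res-type-032's `deltaRegularGeneric_mul_model` (p516044; any variable set). The finiteness
hypotheses for the `g_l` stay hypotheses: square-freeness of `g_l` is res-L1-w45b-stub-4's `squarefree_of_aeval_blowupSubst_eq` (any
`σ`), but for `|σ| ≥ 4` finiteness of the bad primes (isolated singularities of the strict transform) is a genuine geometric input.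

References: H. Matsumura, *Commutative Ring Theory* (1986), Thm. 14.2 [cite: Matsumura1987]; tree files p523916 (res-L1-w45b-stub-1),
p516044 (res-type-032), p525038 (res-L1-w45b-stub-4); res-L1-w45b-lead-2 TARGET-TCPLUS rev 3 / HSUB-ReachTCplus-K5prime.txt
(OURS planning texts, index only).
-/

set_option linter.dupNamespace false -- mandated namespace `Summit.<Summit>.<Problem>` of this single-conjunct summit
set_option linter.overlappingInstances false -- signatures carry both [IsDomain O] and [IsDiscreteValuationRing O]

noncomputable section

namespace Summit.ResolutionOfSingularities.ResolutionOfSingularities.Cruxes.EquisingularLiftNat.Sections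

open MvPolynomial IsLocalRing Literature.AlgebraicGeometry.Resolution Summit.ResolutionOfSingularities.ResolutionOfSingularities.Theorems

/-! ## Centred polynomials under chart substitutions; the blow-up substitution of the `q`-chart -/

section SupportAny

variable {R S : Type*} [CommRing R] [CommRing S]

/-- **Centred polynomials are divisible by `wᵐ` after a substitution dividing every `T_j`, `j ≠ i₀`, by `w`.** If every
monomial `T^α` of `P ∈ R[T_σ]` has `m + α_{i₀} ≤ |α|` (i.e. `Σ_{j ≠ i₀} α_j ≥ m`) and `v : σ → S` is a substitution with
`w ∣ v j` for all `j ≠ i₀`, then `P(v) ∈ (wᵐ)`. [folklore] -/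
theorem aeval_mem_span_pow_of_forall_dvd [Algebra R S] {σ : Type*} [Fintype σ] [DecidableEq σ] (i₀ : σ)
    (v : σ → S) (w : S) (hv : ∀ j, j ≠ i₀ → w ∣ v j) {m : ℕ}
    (P : MvPolynomial σ R) (hP : ∀ α ∈ P.support, m + α i₀ ≤ α.degree) :
    MvPolynomial.aeval v P ∈ Ideal.span {w ^ m} := by
  rw [P.as_sum, map_sum]
  refine Ideal.sum_mem _ fun α hα => ?_
  rw [MvPolynomial.aeval_monomial, Finsupp.prod_fintype _ _ (fun i => by rw [pow_zero]),
    ← Finset.mul_prod_erase Finset.univ (fun j => v j ^ α j) (Finset.mem_univ i₀)]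
  have hdvd : w ^ m ∣ ∏ j ∈ Finset.univ.erase i₀, v j ^ α j := by
    have h1 : w ^ (∑ j ∈ Finset.univ.erase i₀, α j) ∣ ∏ j ∈ Finset.univ.erase i₀, v j ^ α j := by
      rw [← Finset.prod_pow_eq_pow_sum]
      exact Finset.prod_dvd_prod_of_dvd _ _ fun j hj => pow_dvd_pow_of_dvd (hv j (Finset.ne_of_mem_erase hj)) _
    refine (pow_dvd_pow w ?_).trans h1
    have h2 : α i₀ + ∑ j ∈ Finset.univ.erase i₀, α j = α.degree := by
      rw [Finset.add_sum_erase _ _ (Finset.mem_univ i₀), Finsupp.degree_eq_sum]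
    have h3 := hP α hα
    omega
  obtain ⟨b, hb⟩ := hdvd
  rw [hb]
  exact Ideal.mem_span_singleton'.mpr ⟨algebraMap R S (coeff α P) * v i₀ ^ α i₀ * b, by ring⟩

/-- **Centred polynomials go to `J^m` under a substitution with `v j ∈ J` for all `j ≠ i₀`** (the ideal form of the
previous lemma: «multiplicity `≥ m` along the section» read on a frame whose members off `i₀` generate the section ideal).
[folklore] -/
theorem aeval_mem_pow_of_forall_mem [Algebra R S] {σ : Type*} [Fintype σ] [DecidableEq σ] (i₀ : σ)
    (v : σ → S) (J : Ideal S) (hv : ∀ j, j ≠ i₀ → v j ∈ J) {m : ℕ}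
    (P : MvPolynomial σ R) (hP : ∀ α ∈ P.support, m + α i₀ ≤ α.degree) :
    MvPolynomial.aeval v P ∈ J ^ m := by
  rw [P.as_sum, map_sum]
  refine Ideal.sum_mem _ fun α hα => ?_
  rw [MvPolynomial.aeval_monomial, Finsupp.prod_fintype _ _ (fun i => by rw [pow_zero]),
    ← Finset.mul_prod_erase Finset.univ (fun j => v j ^ α j) (Finset.mem_univ i₀), ← mul_assoc]
  refine Ideal.mul_mem_left _ _ ?_
  have h1 : ∏ j ∈ Finset.univ.erase i₀, v j ^ α j ∈ ∏ j ∈ Finset.univ.erase i₀, J ^ α j :=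
    Ideal.prod_mem_prod fun j hj => Ideal.pow_mem_pow (hv j (Finset.ne_of_mem_erase hj)) _
  rw [Finset.prod_pow_eq_pow_sum] at h1
  refine Ideal.pow_le_pow_right ?_ h1
  have h2 : α i₀ + ∑ j ∈ Finset.univ.erase i₀, α j = α.degree := by
    rw [Finset.add_sum_erase _ _ (Finset.mem_univ i₀), Finsupp.degree_eq_sum]
  have h3 := hP α hα
  omega

/-- The composite of the dehomogenisation `T_{i₀} ↦ 1` with a substitution `b` of the remaining variables is the
substitution `T_{i₀} ↦ 1`, `T_j ↦ b j`. [folklore] -/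
theorem aeval_dehomogenize_eq_aeval [Algebra R S] {σ : Type*} [DecidableEq σ] (i₀ : σ)
    (b : {j : σ // j ≠ i₀} → S) (P : MvPolynomial σ R) :
    MvPolynomial.aeval b (dehomogenize i₀ P) =
      MvPolynomial.aeval (fun j : σ => if h : j = i₀ then (1 : S) else b ⟨j, h⟩) P := by
  have hfun : (fun j => MvPolynomial.aeval b (killVar (R := R) i₀ j)) =
      fun j : σ => if h : j = i₀ then (1 : S) else b ⟨j, h⟩ := by
    funext j
    by_cases h : j = i₀
    · subst h
      rw [killVar_self, map_one, dif_pos rfl]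
    · rw [killVar_of_ne i₀ h, MvPolynomial.aeval_X, dif_neg h]
  rw [show MvPolynomial.aeval b (dehomogenize i₀ P) = ((MvPolynomial.aeval b).comp (dehomogenize (R := R) i₀)) P from rfl,
    MvPolynomial.comp_aeval, hfun]

/-- Reduction of coefficients commutes with the affine blow-up substitution `X_l ↦ X_l`, `X_j ↦ X_l·X_j`. [folklore] -/
theorem map_blowupSubst {R S : Type} [CommRing R] [CommRing S] (f : R →+* S) {τ : Type} [DecidableEq τ] (l j : τ) :
    MvPolynomial.map f ((fun j => if j = l then (X l : MvPolynomial τ R) else X l * X j) j) =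
      (fun j => if j = l then (X l : MvPolynomial τ S) else X l * X j) j := by
  by_cases h : j = l
  · simp only [h, if_true, map_X]
  · simp only [h, if_false, map_mul, map_X]

/-- Reduction of coefficients commutes with the strict-transform substitution of the `l`-chart of the blow-up of `q = e_{i₀}`
(dehomogenise at `i₀`, then the affine blow-up substitution with pivot `l`). [folklore] -/
theorem map_aeval_blowupSubst_dehomogenize {R S : Type} [CommRing R] [CommRing S] (f : R →+* S) {σ : Type}
    [DecidableEq σ] (i₀ : σ) (l : {j : σ // j ≠ i₀}) (P : MvPolynomial σ R) :
    MvPolynomial.map f (MvPolynomial.aeval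
        (fun j => if j = l then (X l : MvPolynomial {j : σ // j ≠ i₀} R) else X l * X j) (dehomogenize i₀ P)) =
      MvPolynomial.aeval (fun j => if j = l then (X l : MvPolynomial {j : σ // j ≠ i₀} S) else X l * X j)
        (dehomogenize i₀ (MvPolynomial.map f P)) := by
  rw [map_aeval_of_map_comp f _ _ (map_blowupSubst f l), map_dehomogenize]

/-- The strict-transform substitution of the `l`-chart sends every `T_j`, `j ≠ i₀`, to a multiple of `X_l`; hence a CENTRED
polynomial (`m + α_{i₀} ≤ |α|` on the support) goes to `(X_l^m)`. [folklore] -/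
theorem aeval_blowupSubst_dehomogenize_mem_span_pow [Algebra R S] {σ : Type*} [Fintype σ] [DecidableEq σ] (i₀ : σ)
    (l : {j : σ // j ≠ i₀}) {m : ℕ} (P : MvPolynomial σ R) (hP : ∀ α ∈ P.support, m + α i₀ ≤ α.degree) :
    MvPolynomial.aeval (fun j => if j = l then (X l : MvPolynomial {j : σ // j ≠ i₀} S) else X l * X j)
        (dehomogenize i₀ P) ∈
      Ideal.span {(X l : MvPolynomial {j : σ // j ≠ i₀} S) ^ m} := by
  rw [aeval_dehomogenize_eq_aeval]
  refine aeval_mem_span_pow_of_forall_dvd i₀ _ (X l) (fun j hj => ?_) P hP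
  rw [dif_neg hj]
  by_cases h : (⟨j, hj⟩ : {j : σ // j ≠ i₀}) = l
  · simp only [h, if_true, dvd_refl]
  · simp only [h, if_false]
    exact dvd_mul_right _ _

end SupportAny

/-! ## T-ΔLIFT-CENTRED over an arbitrary finite index set -/

section CentredAny

variable {O : Type} [CommRing O] [IsDomain O] [IsDiscreteValuationRing O] {ϖ : O}
variable {k : Type} [Field k] [Infinite k]
variable {σ : Type} [Fintype σ] [DecidableEq σ]

/-- **T-ΔLIFT-CENTRED in any relative dimension — existence of a Δ-regular centred cone lift.** See the module docstring:
centre `q = e_{i₀}`; charts `T_i = 1` for `i ≠ i₀`; strict-transform charts of the blow-up of `q` with pivots `l ≠ i₀`.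
[cite: Matsumura1987, Thm. 14.2] [OURS · L1 W4.5b] T-ΔLIFT-CENTRED-r toward the any-`n` `stub_elnat_tcPlusPointResolution`
(rung v7 (TC⁺) of the ∀ n parent EL♮); NOT a statement of the manuscript. -/
theorem exists_isHomogeneous_centred_lift_deltaRegular_of_ne (i₀ : σ) (hϖ : Irreducible ϖ) (π : O →+* k)
    (hπ : Function.Surjective π) (hker : RingHom.ker π = Ideal.span {ϖ}) {d m : ℕ} (hmd : m ≤ d)
    (g : MvPolynomial σ k) (hg : g.IsHomogeneous d) (hcen : ∀ α ∈ g.support, m + α i₀ ≤ α.degree)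
    -- finitely many bad primes on every chart `T_i = 1`, `i ≠ i₀`
    (hfin : ∀ i : σ, i ≠ i₀ → {𝔮 : PrimeSpectrum (MvPolynomial {j : σ // j ≠ i} k) |
      dehomogenize i g ∈ 𝔮.asIdeal ∧
      algebraMap (MvPolynomial {j : σ // j ≠ i} k) (Localization.AtPrime 𝔮.asIdeal) (dehomogenize i g) ∈
        maximalIdeal (Localization.AtPrime 𝔮.asIdeal) ^ 2}.Finite)
    -- the downstairs strict transforms on the charts of the blow-up of `q`, with finitely many bad primes
    (gst : {j : σ // j ≠ i₀} → MvPolynomial {j : σ // j ≠ i₀} k)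
    (hgst : ∀ l, MvPolynomial.aeval (fun j => if j = l then (X l : MvPolynomial {j : σ // j ≠ i₀} k) else X l * X j)
      (dehomogenize i₀ g) = X l ^ m * gst l)
    (hfinst : ∀ l, {𝔮 : PrimeSpectrum (MvPolynomial {j : σ // j ≠ i₀} k) | gst l ∈ 𝔮.asIdeal ∧
      algebraMap (MvPolynomial {j : σ // j ≠ i₀} k) (Localization.AtPrime 𝔮.asIdeal) (gst l) ∈
        maximalIdeal (Localization.AtPrime 𝔮.asIdeal) ^ 2}.Finite) :
    ∃ Φ : MvPolynomial σ O, Φ.IsHomogeneous d ∧ MvPolynomial.map π Φ = g ∧ (∀ α ∈ Φ.support, m + α i₀ ≤ α.degree) ∧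
      ∃ Φst : {j : σ // j ≠ i₀} → MvPolynomial {j : σ // j ≠ i₀} O,
        (∀ l, MvPolynomial.aeval (fun j => if j = l then (X l : MvPolynomial {j : σ // j ≠ i₀} O) else X l * X j)
          (dehomogenize i₀ Φ) = X l ^ m * Φst l) ∧
        (∀ l, MvPolynomial.map π (Φst l) = gst l) ∧
        (∀ (i : σ), i ≠ i₀ → ∀ (Q : Ideal (MvPolynomial {j : σ // j ≠ i} O ⧸ Ideal.span {dehomogenize i Φ})) [Q.IsPrime],
          Ideal.Quotient.mk (Ideal.span {dehomogenize i Φ}) (C ϖ : MvPolynomial {j : σ // j ≠ i} O) ∈ Q →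
            IsRegularLocalRing (Localization.AtPrime Q)) ∧
        (∀ (l : {j : σ // j ≠ i₀}) (Q : Ideal (MvPolynomial {j : σ // j ≠ i₀} O ⧸ Ideal.span {Φst l})) [Q.IsPrime],
          Ideal.Quotient.mk (Ideal.span {Φst l}) (C ϖ : MvPolynomial {j : σ // j ≠ i₀} O) ∈ Q →
            IsRegularLocalRing (Localization.AtPrime Q)) := by
  classical
  have hπϖ : π ϖ = 0 := by rw [← RingHom.mem_ker, hker]; exact Ideal.mem_span_singleton_self ϖ
  -- the blow-up substitutions (over `k` and over `O`) of the chart with pivot `l` of the blow-up of `q`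
  let bk : {j : σ // j ≠ i₀} → {j : σ // j ≠ i₀} → MvPolynomial {j : σ // j ≠ i₀} k := fun l j =>
    if j = l then (X l : MvPolynomial {j : σ // j ≠ i₀} k) else X l * X j
  let bO : {j : σ // j ≠ i₀} → {j : σ // j ≠ i₀} → MvPolynomial {j : σ // j ≠ i₀} O := fun l j =>
    if j = l then (X l : MvPolynomial {j : σ // j ≠ i₀} O) else X l * X j
  -- Step 0: the centred degree-`d` forms over `k`
  let V : Submodule k (MvPolynomial σ k) := restrictSupport k {α | α.degree = d ∧ m + α i₀ ≤ α.degree}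
  have hVsupp : ∀ M ∈ V, ((M.support : Finset (σ →₀ ℕ)) : Set (σ →₀ ℕ)) ⊆ {α | α.degree = d ∧ m + α i₀ ≤ α.degree} :=
    fun M hM => hM
  have hVhom : ∀ M ∈ V, MvPolynomial.IsHomogeneous M d := fun M hM α hα => by
    have h := (hVsupp M hM (Finset.mem_coe.mpr (mem_support_iff.mpr hα))).1
    rwa [Finsupp.degree_eq_weight_one] at h
  have hVcen : ∀ M ∈ V, ∀ α ∈ M.support, m + α i₀ ≤ α.degree := fun M hM α hα =>
    (hVsupp M hM (Finset.mem_coe.mpr hα)).2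
  have hmono : ∀ α : σ →₀ ℕ, α.degree = d → m + α i₀ ≤ α.degree → (monomial α (1 : k)) ∈ V := fun α h1 h2 => by
    rw [monomial_mem_restrictSupport]; exact Or.inl ⟨h1, h2⟩
  -- the bad primes: charts `T_i = 1` (`i ≠ i₀`) and the blow-up charts (pivots `l`)
  let B : ∀ i : {i : σ // i ≠ i₀}, Finset (PrimeSpectrum (MvPolynomial {j : σ // j ≠ (i : σ)} k)) :=
    fun i => (hfin i.1 i.2).toFinset
  let Bst : ∀ l : {j : σ // j ≠ i₀}, Finset (PrimeSpectrum (MvPolynomial {j : σ // j ≠ i₀} k)) := fun l => (hfinst l).toFinset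
  -- the bad subspaces of `V`
  let pdehom : ∀ i : σ, Ideal (MvPolynomial {j : σ // j ≠ i} k) → Submodule k V := fun i 𝔮 =>
    (𝔮.restrictScalars k).comap ((dehomogenize i).toLinearMap ∘ₗ V.subtype)
  let ψ : {j : σ // j ≠ i₀} → (MvPolynomial σ k →ₐ[k] MvPolynomial {j : σ // j ≠ i₀} k) := fun l =>
    (MvPolynomial.aeval (bk l)).comp (dehomogenize i₀)
  let pchart : {j : σ // j ≠ i₀} → Ideal (MvPolynomial {j : σ // j ≠ i₀} k) → Submodule k V := fun l 𝔮 =>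
    ((𝔮.restrictScalars k).map (LinearMap.mulLeft k (X l ^ m))).comap ((ψ l).toLinearMap ∘ₗ V.subtype)
  let ι := (Σ i : {i : σ // i ≠ i₀}, B i) ⊕ (Σ l : {j : σ // j ≠ i₀}, Bst l)
  let p : ι → Submodule k V :=
    Sum.elim (fun t => pdehom t.1.1 t.2.1.asIdeal) (fun t => pchart t.1 t.2.1.asIdeal)
  have hmem_dehom : ∀ (i : σ) (𝔮 : Ideal (MvPolynomial {j : σ // j ≠ i} k)) (M : V),
      M ∈ pdehom i 𝔮 ↔ dehomogenize i (M : MvPolynomial σ k) ∈ 𝔮 := fun i 𝔮 M => Iff.rfl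
  have hmem_chart : ∀ (l : {j : σ // j ≠ i₀}) (𝔮 : Ideal (MvPolynomial {j : σ // j ≠ i₀} k)) (M : V), M ∈ pchart l 𝔮 ↔
      ∃ q ∈ 𝔮, X l ^ m * q = MvPolynomial.aeval (bk l) (dehomogenize i₀ (M : MvPolynomial σ k)) := by
    intro l 𝔮 M
    change (MvPolynomial.aeval (bk l) (dehomogenize i₀ (M : MvPolynomial σ k))) ∈
      ((𝔮.restrictScalars k).map (LinearMap.mulLeft k (X l ^ m))) ↔ _
    rw [Submodule.mem_map]
    simp only [Submodule.restrictScalars_mem, LinearMap.mulLeft_apply]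
  -- properness of the bad subspaces: charts `T_i = 1`, `i ≠ i₀` (witness `T_i^d`)
  have hdehom_ne_top : ∀ (i : σ), i ≠ i₀ → ∀ 𝔮 : Ideal (MvPolynomial {j : σ // j ≠ i} k), 𝔮 ≠ ⊤ →
      pdehom i 𝔮 ≠ ⊤ := by
    intro i hi 𝔮 h𝔮 htop
    have hXi : (X i ^ d : MvPolynomial σ k) ∈ V := by
      rw [X_pow_eq_monomial]
      refine hmono _ (Finsupp.degree_single _ _) ?_
      rw [Finsupp.degree_single, Finsupp.single_eq_of_ne' hi]
      omega
    have hmem : (⟨_, hXi⟩ : V) ∈ pdehom i 𝔮 := by rw [htop]; exact Submodule.mem_top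
    rw [hmem_dehom] at hmem
    change dehomogenize i (X i ^ d : MvPolynomial σ k) ∈ 𝔮 at hmem
    rw [map_pow, MvPolynomial.aeval_X, killVar_self, one_pow] at hmem
    exact h𝔮 ((Ideal.eq_top_iff_one _).mpr hmem)
  -- properness: the blow-up charts (witness `T_{i₀}^{d-m} T_l^m ↦ X_l^m`)
  have hev : ∀ l : {j : σ // j ≠ i₀}, MvPolynomial.aeval (bk l)
      (dehomogenize i₀ (X i₀ ^ (d - m) * X (l : σ) ^ m : MvPolynomial σ k)) = X l ^ m := by
    intro l
    rw [aeval_dehomogenize_eq_aeval, map_mul, map_pow, map_pow, MvPolynomial.aeval_X, MvPolynomial.aeval_X,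
      dif_pos rfl, dif_neg l.2, one_pow, one_mul]
    simp [bk]
  have hchart_ne_top : ∀ (l : {j : σ // j ≠ i₀}) (𝔮 : Ideal (MvPolynomial {j : σ // j ≠ i₀} k)), 𝔮 ≠ ⊤ → pchart l 𝔮 ≠ ⊤ := by
    intro l 𝔮 h𝔮 htop
    have hαV : (X i₀ ^ (d - m) * X (l : σ) ^ m : MvPolynomial σ k) ∈ V := by
      rw [X_pow_eq_monomial, X_pow_eq_monomial, monomial_mul, one_mul]
      refine hmono _ ?_ ?_
      · rw [map_add, Finsupp.degree_single, Finsupp.degree_single, Nat.sub_add_cancel hmd]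
      · rw [map_add, Finsupp.degree_single, Finsupp.degree_single, Nat.sub_add_cancel hmd, Finsupp.add_apply,
          Finsupp.single_eq_same, Finsupp.single_eq_of_ne' l.2]
        omega
    have hmem : (⟨_, hαV⟩ : V) ∈ pchart l 𝔮 := by rw [htop]; exact Submodule.mem_top
    rw [hmem_chart] at hmem
    obtain ⟨q, hq, hwq⟩ := hmem
    change X l ^ m * q =
      MvPolynomial.aeval (bk l) (dehomogenize i₀ (X i₀ ^ (d - m) * X (l : σ) ^ m : MvPolynomial σ k)) at hwq
    rw [hev l] at hwq
    have hq1 : q = 1 := mul_left_cancel₀ (pow_ne_zero m (MvPolynomial.X_ne_zero l)) (hwq.trans (mul_one _).symm)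
    exact h𝔮 ((Ideal.eq_top_iff_one _).mpr (hq1 ▸ hq))
  have hp : ∀ t, p t ≠ ⊤ := by
    rintro (⟨i, b⟩ | ⟨l, b⟩)
    · exact hdehom_ne_top i.1 i.2 _ b.1.isPrime.ne_top
    · exact hchart_ne_top l _ b.1.isPrime.ne_top
  -- Step 1: a centred form `M̄` of degree `d` avoiding every bad prime on every chart
  obtain ⟨Mb, hMb⟩ := Submodule.exists_forall_notMem_of_forall_ne_top p hp
  have hMbd : ∀ (i : {i : σ // i ≠ i₀}) (b : B i), dehomogenize (i : σ) (Mb : MvPolynomial σ k) ∉ b.1.asIdeal :=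
    fun i b h => hMb (Sum.inl ⟨i, b⟩) ((hmem_dehom i _ Mb).mpr h)
  have hMbst : ∀ (l : {j : σ // j ≠ i₀}) (b : Bst l), ∀ q,
      X l ^ m * q = MvPolynomial.aeval (bk l) (dehomogenize i₀ (Mb : MvPolynomial σ k)) → q ∉ b.1.asIdeal :=
    fun l b q hq h => hMb (Sum.inr ⟨l, b⟩) ((hmem_chart l _ Mb).mpr ⟨q, h, hq⟩)
  -- Step 2: homogeneous centred lifts `G₀` of `g` and `M` of `M̄`
  obtain ⟨G, hG, hGg, hGsupp⟩ := exists_isHomogeneous_map_eq_support_subset π hπ g hg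
  obtain ⟨M, hM, hMM, hMsupp⟩ := exists_isHomogeneous_map_eq_support_subset π hπ (Mb : MvPolynomial σ k)
    (hVhom _ Mb.2)
  have hGcen : ∀ α ∈ G.support, m + α i₀ ≤ α.degree := fun α hα => hcen α (hGsupp hα)
  have hMcen : ∀ α ∈ M.support, m + α i₀ ≤ α.degree := fun α hα => hVcen _ Mb.2 α (hMsupp hα)
  -- Step 3: the strict transforms on the blow-up charts (divisibility by `X_l^m`) and their reductions
  have hdiv : ∀ (l : {j : σ // j ≠ i₀}) (P : MvPolynomial σ O), (∀ α ∈ P.support, m + α i₀ ≤ α.degree) →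
      ∃ Pl, MvPolynomial.aeval (bO l) (dehomogenize i₀ P) = X l ^ m * Pl := by
    intro l P hP
    obtain ⟨Pl, hPl⟩ := Ideal.mem_span_singleton'.mp
      (aeval_blowupSubst_dehomogenize_mem_span_pow (R := O) (S := O) i₀ l P hP)
    exact ⟨Pl, by rw [← hPl, mul_comm]⟩
  choose Gst hGst using fun l : {j : σ // j ≠ i₀} => hdiv l G hGcen
  choose Mst hMst using fun l : {j : σ // j ≠ i₀} => hdiv l M hMcen
  have hred : ∀ (l : {j : σ // j ≠ i₀}) (P : MvPolynomial σ O) (Pl : MvPolynomial {j : σ // j ≠ i₀} O),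
      MvPolynomial.aeval (bO l) (dehomogenize i₀ P) = X l ^ m * Pl →
      X l ^ m * MvPolynomial.map π Pl = MvPolynomial.aeval (bk l) (dehomogenize i₀ (MvPolynomial.map π P)) := by
    intro l P Pl h
    rw [← map_aeval_blowupSubst_dehomogenize π i₀ l P, h, map_mul, map_pow, map_X]
  have hGstg : ∀ l, MvPolynomial.map π (Gst l) = gst l := fun l => by
    have h := hred l G (Gst l) (hGst l)
    rw [hGg, hgst] at h
    exact mul_left_cancel₀ (pow_ne_zero m (MvPolynomial.X_ne_zero l)) h
  -- Step 4: the exclusion sets of the generic-lift theorem, chart by chart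
  have hGi : ∀ i : σ, MvPolynomial.map π (dehomogenize i G) = dehomogenize i g := fun i => by rw [map_dehomogenize, hGg]
  have hMi : ∀ i, MvPolynomial.map π (dehomogenize i M) = dehomogenize i (Mb : MvPolynomial σ k) := fun i => by
    rw [map_dehomogenize, hMM]
  choose S₁ hS₁ using fun i : {i : σ // i ≠ i₀} =>
    deltaRegularGeneric_mul_model hϖ π hπ hker (dehomogenize (i : σ) G) (dehomogenize (i : σ) M)
      (by rw [hGi]; exact hfin i.1 i.2)
      (by
        intro 𝔮 h1 h2
        rw [hMi]
        rw [hGi] at h1 h2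
        exact hMbd i ⟨𝔮, (hfin i.1 i.2).mem_toFinset.mpr ⟨h1, h2⟩⟩)
  choose S₂ hS₂ using fun l : {j : σ // j ≠ i₀} =>
    deltaRegularGeneric_mul_model hϖ π hπ hker (Gst l) (Mst l)
      (by rw [hGstg]; exact hfinst l)
      (by
        intro 𝔮 h1 h2
        rw [hGstg] at h1 h2
        have h := hred l M (Mst l) (hMst l)
        rw [hMM] at h
        exact hMbst l ⟨𝔮, (hfinst l).mem_toFinset.mpr ⟨h1, h2⟩⟩ _ h)
  -- Step 5: one value of `c` good for every chart
  obtain ⟨y, hy⟩ := Infinite.exists_notMem_finset (Finset.univ.biUnion S₁ ∪ Finset.univ.biUnion S₂)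
  obtain ⟨c, rfl⟩ := hπ y
  have hc₁ : ∀ i, π c ∉ S₁ i := fun i hi => hy (Finset.mem_union_left _ (Finset.mem_biUnion.mpr ⟨i, by simp, hi⟩))
  have hc₂ : ∀ l, π c ∉ S₂ l := fun l hl => hy (Finset.mem_union_right _ (Finset.mem_biUnion.mpr ⟨l, by simp, hl⟩))
  -- the centred cone `Φ = G₀ + c·ϖ·M` and its strict transforms `Φ_l = G_l + c·ϖ·M_l`
  refine ⟨G + C (c * ϖ) * M, hG.add (hM.C_mul _), ?_, ?_, fun l => Gst l + C (c * ϖ) * Mst l, ?_, ?_, ?_, ?_⟩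
  · rw [map_add_C_mul_mul_of_map_eq_zero π hπϖ, hGg]
  · intro α hα
    rcases Finset.mem_union.mp (support_add hα) with h | h
    · exact hGcen α h
    · rw [← smul_eq_C_mul] at h
      exact hMcen α (support_smul h)
  · intro l
    show _ = X l ^ m * (Gst l + C (c * ϖ) * Mst l)
    rw [map_add, map_add, map_mul, map_mul, hGst, hMst, MvPolynomial.algHom_C, AlgHom.commutes,
      MvPolynomial.algebraMap_eq]
    ring
  · intro l
    rw [map_add_C_mul_mul_of_map_eq_zero π hπϖ, hGstg]
  · intro i hi Q _ hQ
    have hdehom : dehomogenize i (G + C (c * ϖ) * M) = dehomogenize i G + C (c * ϖ) * dehomogenize i M := by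
      rw [map_add, map_mul, MvPolynomial.algHom_C, MvPolynomial.algebraMap_eq]
    have key := hS₁ ⟨i, hi⟩ c (hc₁ ⟨i, hi⟩)
    revert Q
    rw [hdehom]
    intro Q _ hQ
    exact key Q hQ
  · intro l Q _ hQ
    exact hS₂ l c (hc₂ l) Q hQ

/-- **T-ΔLIFT-CENTRED in any relative dimension, with `ker π = 𝔪_O`** (the spelling of K5′ / TC⁺-INST: `θ : O ↠ k`; for a
DVR `ker = 𝔪_O = (ϖ)`). [cite: Matsumura1987, Thm. 14.2] [OURS · L1 W4.5b] -/
theorem exists_isHomogeneous_centred_lift_deltaRegular_of_ne' (i₀ : σ) (hϖ : Irreducible ϖ) (π : O →+* k)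
    (hπ : Function.Surjective π) (hker : RingHom.ker π = maximalIdeal O) {d m : ℕ} (hmd : m ≤ d)
    (g : MvPolynomial σ k) (hg : g.IsHomogeneous d) (hcen : ∀ α ∈ g.support, m + α i₀ ≤ α.degree)
    (hfin : ∀ i : σ, i ≠ i₀ → {𝔮 : PrimeSpectrum (MvPolynomial {j : σ // j ≠ i} k) |
      dehomogenize i g ∈ 𝔮.asIdeal ∧
      algebraMap (MvPolynomial {j : σ // j ≠ i} k) (Localization.AtPrime 𝔮.asIdeal) (dehomogenize i g) ∈
        maximalIdeal (Localization.AtPrime 𝔮.asIdeal) ^ 2}.Finite)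
    (gst : {j : σ // j ≠ i₀} → MvPolynomial {j : σ // j ≠ i₀} k)
    (hgst : ∀ l, MvPolynomial.aeval (fun j => if j = l then (X l : MvPolynomial {j : σ // j ≠ i₀} k) else X l * X j)
      (dehomogenize i₀ g) = X l ^ m * gst l)
    (hfinst : ∀ l, {𝔮 : PrimeSpectrum (MvPolynomial {j : σ // j ≠ i₀} k) | gst l ∈ 𝔮.asIdeal ∧
      algebraMap (MvPolynomial {j : σ // j ≠ i₀} k) (Localization.AtPrime 𝔮.asIdeal) (gst l) ∈
        maximalIdeal (Localization.AtPrime 𝔮.asIdeal) ^ 2}.Finite) :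
    ∃ Φ : MvPolynomial σ O, Φ.IsHomogeneous d ∧ MvPolynomial.map π Φ = g ∧ (∀ α ∈ Φ.support, m + α i₀ ≤ α.degree) ∧
      ∃ Φst : {j : σ // j ≠ i₀} → MvPolynomial {j : σ // j ≠ i₀} O,
        (∀ l, MvPolynomial.aeval (fun j => if j = l then (X l : MvPolynomial {j : σ // j ≠ i₀} O) else X l * X j)
          (dehomogenize i₀ Φ) = X l ^ m * Φst l) ∧
        (∀ l, MvPolynomial.map π (Φst l) = gst l) ∧
        (∀ (i : σ), i ≠ i₀ → ∀ (Q : Ideal (MvPolynomial {j : σ // j ≠ i} O ⧸ Ideal.span {dehomogenize i Φ})) [Q.IsPrime],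
          Ideal.Quotient.mk (Ideal.span {dehomogenize i Φ}) (C ϖ : MvPolynomial {j : σ // j ≠ i} O) ∈ Q →
            IsRegularLocalRing (Localization.AtPrime Q)) ∧
        (∀ (l : {j : σ // j ≠ i₀}) (Q : Ideal (MvPolynomial {j : σ // j ≠ i₀} O ⧸ Ideal.span {Φst l})) [Q.IsPrime],
          Ideal.Quotient.mk (Ideal.span {Φst l}) (C ϖ : MvPolynomial {j : σ // j ≠ i₀} O) ∈ Q →
            IsRegularLocalRing (Localization.AtPrime Q)) :=
  exists_isHomogeneous_centred_lift_deltaRegular_of_ne i₀ hϖ π hπ (hker.trans hϖ.maximalIdeal_eq) hmd g hg hcen hfin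
    gst hgst hfinst

end CentredAny

end Summit.ResolutionOfSingularities.ResolutionOfSingularities.Cruxes.EquisingularLiftNat.Sections

end
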